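import Literature.AlgebraicGeometry.Motives.HodgeTensor
import HarnessLib

/-!
# Discharged fact: the dual Hodge filtration is opposed to its conjugate

(Sibling proofs file of `Literature.AlgebraicGeometry.Motives.HodgeTensor`; the separation of
the dual filtration, `exists_dualFiltration_eq_bot_holds`, with `dualBaseChange_injective` for
arbitrary `V`, lives in `Literature.AlgebraicGeometry.Motives.HodgeTensorDualProofs`.)

`Literature.AlgebraicGeometry.Motives.HodgeTensor` records as a named fact
(`Literature.HodgeStructure.isCompl_dualFiltration : Prop`) that for a pure `ℚ`-Hodge structure `H` of
weight `n` on a finite-dimensional `ℚ`-vector space `V`, the dual filtration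
`F^p V^∨ := (F^{1-p} V)^⊥` on `ℂ ⊗ V^∨` (pulled back along the comparison map
`dualBaseChange V : ℂ ⊗ V^∨ → (ℂ ⊗ V)^∨`) is `(-n)`-opposed to its complex conjugate:
`F^p V^∨ ⊕ conj F^q V^∨ = ℂ ⊗ V^∨` whenever `p + q = -n + 1`. This is the statement that the dual
of a Hodge structure of weight `n` is a Hodge structure of weight `-n` (Deligne, *Théorie de
Hodge II*, 1.1.7: the dual filtration `F^p(A^∨) = (F^{1-p} A)^⊥`, and 1.2.5: two finite
filtrations are `n`-opposed iff `F^p ⊕ F̄^q = A` for `p + q = n + 1`; Cattani–El Zein–Griffiths–Lê,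
*Hodge Theory*, §3.1.1.3: "In particular, the dual `H^*` to `H` is an HS of weight `-n`", with
§3.2.1.6 (filtrations on `Hom` and `⊗`, following Deligne) and Def. 3.2.8 / Prop. 3.2.10 (the
`F^p ⊕ G^q ≅ A` form of `n`-opposedness)). This file proves it
(`Literature.AlgebraicGeometry.Motives.HodgeStructure.isCompl_dualFiltration_holds`), so users holding `(h : isCompl_dualFiltration)`
(the field `HodgeTensorFacts.isCompl_dualFiltration`) can discharge the hypothesis.

## Proof

If `p + q = -n + 1` then `(1 - p) + (1 - q) = n + 1`, so `F^{1-p} ⊕ conj F^{1-q} = V_ℂ` by the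
opposedness axiom of `H`. Dual annihilators carry direct-sum decompositions of a vector space to
direct-sum decompositions of its dual (Mathlib's `Subspace.isCompl_dualAnnihilator`:
`(A ⊓ B)^⊥ = A^⊥ ⊔ B^⊥`, `(A ⊔ B)^⊥ = A^⊥ ⊓ B^⊥`), giving
`(F^{1-p})^⊥ ⊕ (conj F^{1-q})^⊥ = (V_ℂ)^∨`. For `V` finite-dimensional the comparison map
`dualBaseChange V` is bijective — it is the map underlying Mathlib's base-change isomorphism
`IsBaseChange.toDualBaseChange` for the base change `v ↦ 1 ⊗ v` (`TensorProduct.isBaseChange`),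
both sending `c ⊗ φ` to `d ⊗ v ↦ c d φ(v)` — so pulling back along it is an order isomorphism of
subspace lattices (`Submodule.orderIsoMapComapOfBijective`) and preserves complements. Finally
complex conjugation commutes with annihilators through `dualBaseChange`:
`conj ((W)^⊥) = (conj W)^⊥`, because `dualBaseChange V (conj ξ) x = conj (dualBaseChange V ξ (conj x))`
(rational linear forms are real). About 60 lines; no choice of basis is made explicitly.

## References

* P. Deligne, *Théorie de Hodge. II*, Publ. Math. IHÉS 40 (1971), 5–57, (1.1.7) (dual of a
  filtered object) and (1.2.5) (opposed filtrations) — the locators carried by the fact's cite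
  tag. [DeligneHodgeII1971] (Not held in the literature store at the time of writing; acquisition
  requested. The statement proved is the vendored one, unchanged.)
* E. Cattani, F. El Zein, P. A. Griffiths, Lê D. T. (eds.), *Hodge Theory*, Mathematical Notes 49,
  Princeton University Press (2014), Ch. 3 (El Zein–Lê), §3.1.1.3 (tensor product, Hom and dual
  of Hodge structures; held copy PDF p. 132), §3.2.1.6 (PDF p. 154), Def. 3.2.8 and Prop. 3.2.10
  (PDF pp. 155–156). [CattaniElZeinGriffithsLe2014]
-/

open scoped TensorProduct

noncomputable section

namespace Literature.AlgebraicGeometry.Motives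

namespace HodgeStructure

universe u

variable {V : Type u} [AddCommGroup V] [Module ℚ V] {n : ℤ}

/-- `dualBaseChange` intertwines complex conjugation on `ℂ ⊗ V^∨` with complex conjugation on
`ℂ ⊗ V` and on `ℂ`: `dBC (conj ξ) x = conj (dBC ξ (conj x))` — rational linear forms are real.
On pure tensors: `conj c · φ(v) d = conj (c · φ(v) conj d)`. [folklore] -/
theorem dualBaseChange_conj (ξ : ℂ ⊗[ℚ] Module.Dual ℚ V) (x : ℂ ⊗[ℚ] V) :
    dualBaseChange V (conj ξ) x = starRingEnd ℂ (dualBaseChange V ξ (conj x)) := by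
  induction ξ using TensorProduct.induction_on with
  | zero => simp
  | tmul c φ =>
    induction x using TensorProduct.induction_on with
    | zero => simp
    | tmul d v =>
      simp only [conj_tmul, dualBaseChange_tmul_tmul, map_rat_smul, map_mul, starRingEnd_self_apply]
    | add x y hx hy => simp only [map_add, hx, hy]
  | add ξ η hξ hη => simp only [map_add, LinearMap.add_apply, hξ, hη]

/-- Complex conjugation commutes with the dual filtration:
`conj (F^q V^∨) = (conj F^{1-q} V)^⊥` (pulled back along `dualBaseChange`), i.e.
`conj (W^⊥) = (conj W)^⊥` for `W = F^{1-q}` (Deligne, Hodge II, 1.1.7 with the real structure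
of 2.1.4). [folklore] -/
theorem complexConj_dualFiltration (H : HodgeStructure V n) (q : ℤ) :
    complexConj (H.dualFiltration q) =
      (complexConj (H.F (1 - q))).dualAnnihilator.comap (dualBaseChange V) := by
  ext ξ
  simp only [mem_complexConj, Submodule.mem_comap, Submodule.mem_dualAnnihilator,
    mem_dualFiltration_iff]
  constructor
  · intro h y hy
    have := h (conj y) hy
    rwa [dualBaseChange_conj, conj_conj, map_eq_zero] at this
  · intro h x hx
    rw [dualBaseChange_conj, h (conj x) (by simpa using hx), map_zero]

/-- For `V` finite-dimensional, `dualBaseChange V` is (the map underlying) Mathlib's base-change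
isomorphism `IsBaseChange.toDualBaseChange : ℂ ⊗ V^∨ ≃ₗ[ℂ] (ℂ ⊗ V)^∨` for the base change
`v ↦ 1 ⊗ v` (`TensorProduct.isBaseChange ℚ V ℂ`): both send `c ⊗ φ` to `d ⊗ v ↦ c d φ(v)`
(`dualBaseChange_tmul_tmul`, `IsBaseChange.toDualBaseChange_tmul`). [folklore] -/
theorem coe_dualBaseChange_eq_toDualBaseChange [Module.Finite ℚ V] :
    (dualBaseChange V : ℂ ⊗[ℚ] Module.Dual ℚ V → Module.Dual ℂ (ℂ ⊗[ℚ] V)) =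
      (TensorProduct.isBaseChange ℚ V ℂ).toDualBaseChange := by
  have : dualBaseChange V =
      ((TensorProduct.isBaseChange ℚ V ℂ).toDualBaseChange : _ →ₗ[ℂ] _) := by
    refine TensorProduct.AlgebraTensorModule.ext fun c φ => ?_
    refine TensorProduct.AlgebraTensorModule.ext fun d v => ?_
    have hd : d ⊗ₜ[ℚ] v = d • (TensorProduct.mk ℚ ℂ V 1 v) := by
      simp [TensorProduct.smul_tmul']
    rw [dualBaseChange_tmul_tmul, hd, LinearEquiv.coe_coe, map_smul,
      IsBaseChange.toDualBaseChange_tmul, smul_eq_mul, Algebra.smul_def]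
    simp only [eq_ratCast]
    ring
  exact congrArg (fun f : ℂ ⊗[ℚ] Module.Dual ℚ V →ₗ[ℂ] Module.Dual ℂ (ℂ ⊗[ℚ] V) => ⇑f) this

/-- For `V` finite-dimensional, the comparison map `dualBaseChange V : ℂ ⊗ V^∨ → (ℂ ⊗ V)^∨` is
bijective: taking duals commutes with base change for finite free modules (Mathlib's
`IsBaseChange.dual` / `IsBaseChange.toDualBaseChange`). (False without finiteness: the map is
then injective but not surjective.) [folklore] -/
theorem dualBaseChange_bijective [Module.Finite ℚ V] : Function.Bijective (dualBaseChange V) := by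
  rw [coe_dualBaseChange_eq_toDualBaseChange]
  exact LinearEquiv.bijective _

/-- **Discharge of the named fact `isCompl_dualFiltration`**: for `V` finite-dimensional and `H` a
pure `ℚ`-Hodge structure of weight `n` on `V`, the dual filtration `F^p V^∨ = (F^{1-p} V)^⊥` is
`(-n)`-opposed to its complex conjugate, `F^p V^∨ ⊕ conj F^q V^∨ = ℂ ⊗ V^∨` for `p + q = -n + 1`
— the dual Hodge structure `H^∨` of weight `-n` (Deligne, *Théorie de Hodge II*, 1.1.7 and
1.2.5; Cattani–El Zein–Griffiths–Lê, *Hodge Theory*, §3.1.1.3: "the dual `H^*` to `H` is an HS of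
weight `-n`", Prop. 3.2.10). Proof: `(1 - p) + (1 - q) = n + 1` gives
`F^{1-p} ⊕ conj F^{1-q} = V_ℂ` (`isCompl_F_complexConj`); annihilators give
`(F^{1-p})^⊥ ⊕ (conj F^{1-q})^⊥ = V_ℂ^∨` (`Subspace.isCompl_dualAnnihilator`); pulling back along
the bijection `dualBaseChange V` (`dualBaseChange_bijective`,
`Submodule.orderIsoMapComapOfBijective`) preserves complements; and
`(conj F^{1-q})^⊥ = conj ((F^{1-q})^⊥)` (`complexConj_dualFiltration`).
[cite: DeligneHodgeII1971, 1.1.7 and 1.2.5] -/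
theorem isCompl_dualFiltration_holds : isCompl_dualFiltration (V := V) (n := n) := by
  intro _ H p q hpq
  rw [complexConj_dualFiltration]
  exact (Submodule.orderIsoMapComapOfBijective (dualBaseChange V)
    dualBaseChange_bijective).symm.isCompl
      (Subspace.isCompl_dualAnnihilator (H.isCompl_F_complexConj (1 - p) (1 - q) (by omega)))

end HodgeStructure

end Literature.AlgebraicGeometry.Motives

end
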